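import Summits.CriticalPhenomena.CardyFormulaZ2.Theorems.CardyWhiteToColouredSimilarityUpgradeRectangleContinuity
import Summits.CriticalPhenomena.CardyFormulaZ2.Theorems.CardyWhiteToColouredSimilarityUpgradeStubRectangleDuality
import Summits.CriticalPhenomena.CardyFormulaZ2.Theorems.CardyAnchoredRigiditySubseqCardySquareHalf

/-!
# Boxes at finite mesh for stub S5a `stub_rectSubseqLimits` of line `Sketch`
# (crux `DyadicLatticeBetaLaw`, stmt-CriticalPhenomena-18183, route DyadicBetaRigidity of
# `CardyFormulaZ2`)

Support file (pure percolation, finite mesh `δ = 1/(k+2)`, no limits) for the corner-marked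
boxes `(0, w) × (0, 1)`: the left–right family `Q w` (arcs `0, 2` = left, right sides) and the
bottom–top family `Q' w` (arcs `0, 2` = bottom, top sides). All inputs are landed technology of
crux `SimilarityUpgrade` (stmt-CriticalPhenomena-4597).

* `lr_eq`, `bt_bounds`: in the window `a + 1 < w (k+2) ≤ a + 2` (`JointLimit.exists_window`),
  `P[Q w, δ] = crossingProb half a k` (`RectangleDuality.bond_lr_eq`) and
  `crossingProb half k (a-1) ≤ P[Q' w, δ] ≤ crossingProb half k a` (`le_bond_bt`, `bond_bt_le`,
  `real_shift_tbCrossing`).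
* `lr_local`: near every `w₀ > 0`, `w ↦ P[Q w, 1/(k+2)]` is antitone and moves by at most `η`,
  uniformly in `k ≥ K` — the window arithmetic of `stub_rectangleContinuity` at finite mesh, fed
  with the mesh-uniform equicontinuity `crossingProb_uniformIncrement`.
* `bt_dual` (registered as `stub_rectSubseqLimits_boxDuality`):
  `1 - P[Q w, δ] ≤ P[Q' w, δ] ≤ 1 - P[Q w, δ] + 2η` for `k ≥ K(w, η)` — exact duality
  `crossingProb_add_crossingProb_symm_holds` (three times), monotonicity `crossingProb_anti_left`
  and two unit width increments bounded by `crossingProb_uniformIncrement`.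

References: O. Schramm, S. Smirnov, Ann. Probab. 39 (2011), Lemma 6.1; B. Bollobás, O. Riordan,
*Percolation* (2006), Ch. 3 Lemma 1 and Ch. 7 §7.1; G. Grimmett, *Percolation* (1999), §11.7.
-/

noncomputable section
open MeasureTheory Filter Set Metric Topology
open UpperHalfPlane (upperHalfPlaneSet)
open Literature.Probability.RandomPlanarGeometry Literature.Probability.LatticeModels
open Literature.Probability.Percolation
namespace Summit.CriticalPhenomena.CardyFormulaZ2.Cruxes.DyadicLatticeBetaLaw.Stubs

open Summit.CriticalPhenomena.CardyFormulaZ2.Cruxes.SimilarityUpgrade.Stubs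
open Summit.CriticalPhenomena.CardyFormulaZ2.Cruxes.SimilarityUpgrade.Stubs.RectangleDuality
open Summit.CriticalPhenomena.CardyFormulaZ2.Cruxes.SubseqCardy.Birth.JointLimit (exists_window)

namespace RectSubseqLimits

variable {Q Q' : ℝ → ConformalRectangle}

/-! ### Finite-mesh bookkeeping -/

/-- **Exact identification (LR)** at mesh `1/(k+2)`: in the window `a + 1 < w (k+2) ≤ a + 2`,
`a ≥ 1`, `P[Q w, 1/(k+2)] = crossingProb half a k` (`RectangleDuality.bond_lr_eq`). [folklore] -/
theorem lr_eq (hQ : ∀ w : ℝ, 0 < w → (Q w).carrier = (Ioo (0 : ℝ) w ×ℂ Ioo (0 : ℝ) 1) ∧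
      (Q w).arc 0 = {z : ℂ | z.re = 0 ∧ z.im ∈ Icc (0 : ℝ) 1} ∧
      (Q w).arc 2 = {z : ℂ | z.re = w ∧ z.im ∈ Icc (0 : ℝ) 1})
    {w : ℝ} (hw : 0 < w) {k a : ℕ} (ha1 : (a : ℝ) + 1 < w * ((k : ℝ) + 2))
    (ha2 : w * ((k : ℝ) + 2) ≤ a + 2) (h1a : 1 ≤ a) :
    bondDomainCrossingProb (Q w) (1 / ((k : ℝ) + 2)) = crossingProb half a k := by
  have hK : (0 : ℝ) < (k : ℝ) + 2 := by positivity
  exact bond_lr_eq (Q w) (hQ w hw).1 (hQ w hw).2.1 (hQ w hw).2.2 (by positivity)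
    (by rwa [one_div_mul_eq_div, div_lt_iff₀ hK]) (by rwa [one_div_mul_eq_div, le_div_iff₀ hK])
    (one_div_mul_cancel hK.ne') h1a

/-- **Squeeze (BT)** at mesh `1/(k+2)`: in the window `a' + 2 < w (k+2) ≤ a' + 3`,
`crossingProb half k a' ≤ P[Q' w, 1/(k+2)] ≤ crossingProb half k (a' + 1)`
(`le_bond_bt`, `bond_bt_le`, `real_shift_tbCrossing`). [folklore] -/
theorem bt_bounds (hQ' : ∀ w : ℝ, 0 < w → (Q' w).carrier = (Ioo (0 : ℝ) w ×ℂ Ioo (0 : ℝ) 1) ∧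
      (Q' w).arc 0 = {z : ℂ | z.im = 0 ∧ z.re ∈ Icc (0 : ℝ) w} ∧
      (Q' w).arc 2 = {z : ℂ | z.im = 1 ∧ z.re ∈ Icc (0 : ℝ) w})
    {w : ℝ} (hw : 0 < w) {k a' : ℕ} (ha1 : (a' : ℝ) + 2 < w * ((k : ℝ) + 2))
    (ha2 : w * ((k : ℝ) + 2) ≤ a' + 3) :
    crossingProb half k a' ≤ bondDomainCrossingProb (Q' w) (1 / ((k : ℝ) + 2)) ∧
      bondDomainCrossingProb (Q' w) (1 / ((k : ℝ) + 2)) ≤ crossingProb half k (a' + 1) := by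
  have hK : (0 : ℝ) < (k : ℝ) + 2 := by positivity
  have hδ : (0 : ℝ) < 1 / ((k : ℝ) + 2) := by positivity
  have ha : 1 / ((k : ℝ) + 2) * (((a' + 1 : ℕ) : ℝ) + 1) < w := by
    rw [one_div_mul_eq_div, div_lt_iff₀ hK]; push_cast; linarith
  have ha' : w ≤ 1 / ((k : ℝ) + 2) * (((a' + 1 : ℕ) : ℝ) + 2) := by
    rw [one_div_mul_eq_div, le_div_iff₀ hK]; push_cast; linarith
  have hb : 1 / ((k : ℝ) + 2) * ((k : ℝ) + 2) = 1 := one_div_mul_cancel hK.ne'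
  constructor
  · rw [← real_shift_tbCrossing a' k]
    exact le_bond_bt (Q' w) (hQ' w hw).1 (hQ' w hw).2.1 (hQ' w hw).2.2 hδ ha ha' hb le_rfl
  · rw [← real_shift_tbCrossing (a' + 1) k]
    exact bond_bt_le (Q' w) (hQ' w hw).1 (hQ' w hw).2.1 (hQ' w hw).2.2 hδ ha ha' hb

/-- **Local monotonicity and equicontinuity in the width, uniformly in the mesh** (the window
arithmetic of `stub_rectangleContinuity` at finite mesh, fed with
`crossingProb_uniformIncrement`): near `w₀ > 0`, for `w₁ ≤ w₂` in `(w₀ - ρ, w₀ + ρ)` and all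
`k ≥ K`, `P[Q w₂, 1/(k+2)] ≤ P[Q w₁, 1/(k+2)] ≤ P[Q w₂, 1/(k+2)] + η`.
[cite: SchrammSmirnov2011, Lemma 6.1] [cite: BollobasRiordan2006, Ch. 7 §7.1 pp. 183–185] -/
theorem lr_local (hQ : ∀ w : ℝ, 0 < w → (Q w).carrier = (Ioo (0 : ℝ) w ×ℂ Ioo (0 : ℝ) 1) ∧
      (Q w).arc 0 = {z : ℂ | z.re = 0 ∧ z.im ∈ Icc (0 : ℝ) 1} ∧
      (Q w).arc 2 = {z : ℂ | z.re = w ∧ z.im ∈ Icc (0 : ℝ) 1})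
    {w₀ : ℝ} (hw₀ : 0 < w₀) {η : ℝ} (hη : 0 < η) :
    ∃ ρ : ℝ, 0 < ρ ∧ ρ ≤ w₀ / 2 ∧ ∃ K : ℕ, ∀ k : ℕ, K ≤ k → ∀ w₁ w₂ : ℝ,
      w₀ - ρ < w₁ → w₁ ≤ w₂ → w₂ < w₀ + ρ →
      bondDomainCrossingProb (Q w₂) (1 / ((k : ℝ) + 2)) ≤
          bondDomainCrossingProb (Q w₁) (1 / ((k : ℝ) + 2)) ∧
        bondDomainCrossingProb (Q w₁) (1 / ((k : ℝ) + 2)) ≤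
          bondDomainCrossingProb (Q w₂) (1 / ((k : ℝ) + 2)) + η := by
  -- the comparability constant `α` and the increment data `ε`, `k₀` at accuracy `η`
  obtain ⟨α, hα0, hα1, hα2⟩ : ∃ α : ℝ, 0 < α ∧ α ≤ w₀ / 4 ∧ α ≤ 1 / (4 * w₀) :=
    ⟨min (w₀ / 4) (1 / (4 * w₀)), lt_min (by positivity) (by positivity), min_le_left _ _,
      min_le_right _ _⟩
  obtain ⟨ε, hε, k₀, hk₀⟩ := crossingProb_uniformIncrement α hα0 η hη
  obtain ⟨K₁, hK₁⟩ := exists_nat_ge (8 / w₀ + 2 / ε + 2)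
  refine ⟨min (w₀ / 2) (ε / 8), lt_min (by positivity) (by positivity), min_le_left _ _,
    max k₀ K₁, fun k hk w₁ w₂ hw₁ h12 hw₂ => ?_⟩
  have hρ1 := min_le_left (w₀ / 2) (ε / 8)
  have hρ2 := min_le_right (w₀ / 2) (ε / 8)
  have hw₁' : w₀ / 2 < w₁ := by linarith
  have hw₂' : w₂ < 2 * w₀ := by linarith
  have hd : w₂ - w₁ ≤ ε / 4 := by linarith
  have hw₁0 : 0 < w₁ := by linarith
  have hw₂0 : 0 < w₂ := by linarith
  have hkk₀ : k₀ ≤ k := le_of_max_le_left hk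
  have hkK₁ : (K₁ : ℝ) ≤ k := by exact_mod_cast le_of_max_le_right hk
  have hp1 : 0 < 8 / w₀ := by positivity
  have hp2 : 0 < 2 / ε := by positivity
  have hk1 : 8 / w₀ ≤ k := by linarith
  have hk2 : 2 / ε ≤ (k : ℝ) - 2 := by linarith
  have hk3 : (2 : ℝ) ≤ k := by linarith
  rw [div_le_iff₀ hw₀] at hk1
  rw [div_le_iff₀ hε] at hk2
  -- products used by `linarith`
  have hm1 : w₀ / 2 * ((k : ℝ) + 2) ≤ w₁ * ((k : ℝ) + 2) :=
    mul_le_mul_of_nonneg_right hw₁'.le (by positivity)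
  have hm2 : w₂ * ((k : ℝ) + 2) ≤ 2 * w₀ * ((k : ℝ) + 2) :=
    mul_le_mul_of_nonneg_right hw₂'.le (by positivity)
  have hm12 : w₁ * ((k : ℝ) + 2) ≤ w₂ * ((k : ℝ) + 2) :=
    mul_le_mul_of_nonneg_right h12 (by positivity)
  have hm3 : (w₂ - w₁) * ((k : ℝ) + 2) ≤ ε / 4 * ((k : ℝ) + 2) :=
    mul_le_mul_of_nonneg_right hd (by positivity)
  have hm4 : w₀ * 2 ≤ w₀ * k := mul_le_mul_of_nonneg_left hk3 hw₀.le
  obtain ⟨a₁, h1l, h1u⟩ := exists_window (x := w₁ * ((k : ℝ) + 2)) (by linarith)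
  obtain ⟨a₂, h2l, h2u⟩ := exists_window (x := w₂ * ((k : ℝ) + 2)) (by linarith)
  have h1a₁ : 1 ≤ a₁ := by
    have : (0 : ℝ) < a₁ := by linarith
    have : 0 < a₁ := by exact_mod_cast this
    omega
  have hle : a₁ ≤ a₂ := by
    have : (a₁ : ℝ) < a₂ + 1 := by linarith
    have : a₁ < a₂ + 1 := by exact_mod_cast this
    omega
  rw [lr_eq hQ hw₁0 h1l h1u h1a₁, lr_eq hQ hw₂0 h2l h2u (h1a₁.trans hle)]
  obtain ⟨j, rfl⟩ : ∃ j, a₂ = a₁ + j := ⟨a₂ - a₁, by omega⟩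
  push_cast at h2l h2u
  have hb : |crossingProb half a₁ k - crossingProb half (a₁ + j) k| ≤ η := by
    refine hk₀ k a₁ j hkk₀ ?_ ?_ ?_
    · -- `α k ≤ a₁`
      have : α * k ≤ w₀ / 4 * k := mul_le_mul_of_nonneg_right hα1 (Nat.cast_nonneg k)
      linarith
    · -- `a₁ ≤ k / α`
      rw [le_div_iff₀ hα0]
      have h4 : (0 : ℝ) < 4 * w₀ := by positivity
      have h5 : (a₁ : ℝ) * α ≤ a₁ * (1 / (4 * w₀)) :=
        mul_le_mul_of_nonneg_left hα2 (Nat.cast_nonneg _)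
      have h6 : (a₁ : ℝ) * (1 / (4 * w₀)) ≤ k := by
        rw [mul_one_div, div_le_iff₀ h4]
        linarith
      linarith
    · -- `j ≤ ε k`
      linarith
  exact ⟨crossingProb_anti_left half (Nat.le_add_right a₁ j) k,
    by linarith [(abs_sub_le_iff.1 hb).1]⟩

/-- **Box duality at finite mesh, up to `2η`**: for `k ≥ K(w, η)`,
`1 - P[Q w, 1/(k+2)] ≤ P[Q' w, 1/(k+2)] ≤ 1 - P[Q w, 1/(k+2)] + 2η`. With the window `a`:
`1 - crossingProb half a k = crossingProb half (k+1) (a-1) ≤ crossingProb half k (a-1) ≤ P[Q' w]`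
exactly (duality, monotonicity, `le_bond_bt`), and
`P[Q' w] ≤ crossingProb half k a ≤ crossingProb half k (a-1) + η`
`≤ crossingProb half (k+1) (a-1) + 2η`
(the height increment converted into a width increment at height `k - 1` by two more dualities;
both unit increments bounded by `crossingProb_uniformIncrement`).
[cite: BollobasRiordan2006, Ch. 3 Lemma 1 and Ch. 7 §7.1] [cite: SchrammSmirnov2011, Lemma 6.1] -/
theorem bt_dual (hQ : ∀ w : ℝ, 0 < w → (Q w).carrier = (Ioo (0 : ℝ) w ×ℂ Ioo (0 : ℝ) 1) ∧
      (Q w).arc 0 = {z : ℂ | z.re = 0 ∧ z.im ∈ Icc (0 : ℝ) 1} ∧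
      (Q w).arc 2 = {z : ℂ | z.re = w ∧ z.im ∈ Icc (0 : ℝ) 1})
    (hQ' : ∀ w : ℝ, 0 < w → (Q' w).carrier = (Ioo (0 : ℝ) w ×ℂ Ioo (0 : ℝ) 1) ∧
      (Q' w).arc 0 = {z : ℂ | z.im = 0 ∧ z.re ∈ Icc (0 : ℝ) w} ∧
      (Q' w).arc 2 = {z : ℂ | z.im = 1 ∧ z.re ∈ Icc (0 : ℝ) w})
    {w : ℝ} (hw : 0 < w) {η : ℝ} (hη : 0 < η) :
    ∃ K : ℕ, ∀ k : ℕ, K ≤ k →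
      1 - bondDomainCrossingProb (Q w) (1 / ((k : ℝ) + 2)) ≤
          bondDomainCrossingProb (Q' w) (1 / ((k : ℝ) + 2)) ∧
        bondDomainCrossingProb (Q' w) (1 / ((k : ℝ) + 2)) ≤
          1 - bondDomainCrossingProb (Q w) (1 / ((k : ℝ) + 2)) + 2 * η := by
  obtain ⟨α, hα0, hα1, hα2⟩ : ∃ α : ℝ, 0 < α ∧ α ≤ w / 4 ∧ α ≤ 1 / (4 * w) :=
    ⟨min (w / 4) (1 / (4 * w)), lt_min (by positivity) (by positivity), min_le_left _ _,
      min_le_right _ _⟩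
  obtain ⟨ε, hε, k₀, hk₀⟩ := crossingProb_uniformIncrement α hα0 η hη
  obtain ⟨K, hK⟩ :=
    exists_nat_ge (((k₀ : ℝ) + 1 / ε + 4) / w + ((k₀ : ℝ) + 1 / ε + 4) + 1)
  refine ⟨K, fun k hk => ?_⟩
  have hkR : (K : ℝ) ≤ k := by exact_mod_cast hk
  have hε1 : 0 < 1 / ε := by positivity
  have hq0 : 0 ≤ ((k₀ : ℝ) + 1 / ε + 4) / w := by positivity
  have hk1 : (k₀ : ℝ) + 1 / ε + 4 + 1 ≤ k := by linarith
  have hk2 : (k₀ : ℝ) + 1 / ε + 4 ≤ w * k := by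
    have : ((k₀ : ℝ) + 1 / ε + 4) / w ≤ k := by linarith
    rw [div_le_iff₀ hw] at this
    linarith
  have hx : w * ((k : ℝ) + 2) = w * k + 2 * w := by ring
  have h4w : (0 : ℝ) < 4 * w := by positivity
  have hw5 : w * 5 ≤ w * k := mul_le_mul_of_nonneg_left (by linarith) hw.le
  -- the window `a' + 2 < w (k + 2) ≤ a' + 3` and `k = k' + 1`
  obtain ⟨a, ha1, ha2⟩ := exists_window (x := w * ((k : ℝ) + 2)) (by linarith)
  have h2a : 2 ≤ a := by
    have : (1 : ℝ) < a := by linarith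
    have : 1 < a := by exact_mod_cast this
    omega
  obtain ⟨a', rfl⟩ : ∃ a', a = a' + 1 := ⟨a - 1, by omega⟩
  push_cast at ha1 ha2
  have hA0 : (0 : ℝ) ≤ a' := Nat.cast_nonneg a'
  obtain ⟨k', hk'⟩ : ∃ k', k' + 1 = k :=
    ⟨k - 1, by have : (1 : ℝ) ≤ k := by linarith
               have : 1 ≤ k := by exact_mod_cast this
               omega⟩
  have hk'R : (k' : ℝ) + 1 = k := by exact_mod_cast hk'
  have hαk' : α * (k' : ℝ) = α * k - α := by rw [← hk'R]; ring
  have hk'w : (k' : ℝ) * (4 * w) = k * (4 * w) - 4 * w := by rw [← hk'R]; ring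
  -- identification, squeeze, dualities, monotonicity
  have hlr : bondDomainCrossingProb (Q w) (1 / ((k : ℝ) + 2)) = crossingProb half (a' + 1) k :=
    lr_eq hQ hw (by push_cast; linarith) (by push_cast; linarith) (Nat.le_add_left 1 a')
  obtain ⟨hlo, hhi⟩ := bt_bounds hQ' hw (k := k) (a' := a') (by linarith) (by linarith)
  have d1 := crossingProb_add_crossingProb_symm_holds half a' k
  have d2 := crossingProb_add_crossingProb_symm_holds half k' (a' + 1)
  have d3 := crossingProb_add_crossingProb_symm_holds half k' a'
  rw [symm_half] at d1 d2 d3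
  rw [hk'] at d2 d3
  have m1 : crossingProb half (k + 1) a' ≤ crossingProb half k a' :=
    crossingProb_anti_left half (Nat.le_succ k) a'
  -- the aspect and size conditions of the two unit increments
  have c1 : k₀ ≤ a' := by
    have : (k₀ : ℝ) ≤ a' := by linarith
    exact_mod_cast this
  have c2 : α * (a' : ℝ) ≤ k := by
    have h5 : α * (a' : ℝ) ≤ 1 / (4 * w) * a' := mul_le_mul_of_nonneg_right hα2 hA0
    have h6 : 1 / (4 * w) * (a' : ℝ) ≤ k := by
      rw [one_div_mul_eq_div, div_le_iff₀ h4w]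
      linarith
    linarith
  have c3 : (k : ℝ) ≤ a' / α := by
    rw [le_div_iff₀ hα0]
    have : (k : ℝ) * α ≤ k * (w / 4) := mul_le_mul_of_nonneg_left hα1 (Nat.cast_nonneg k)
    linarith
  have c4 : ((1 : ℕ) : ℝ) ≤ ε * a' := by
    have : 1 / ε < a' := by linarith
    rw [div_lt_iff₀ hε] at this
    push_cast
    linarith
  have c5 : k₀ ≤ k' := by
    have : (k₀ : ℝ) ≤ k' := by linarith
    exact_mod_cast this
  have c6 : α * (k' : ℝ) ≤ ((a' + 1 : ℕ) : ℝ) := by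
    have : (k : ℝ) * α ≤ k * (w / 4) := mul_le_mul_of_nonneg_left hα1 (Nat.cast_nonneg k)
    push_cast
    linarith
  have c7 : ((a' + 1 : ℕ) : ℝ) ≤ k' / α := by
    rw [le_div_iff₀ hα0]
    push_cast
    have h5 : ((a' : ℝ) + 1) * α ≤ ((a' : ℝ) + 1) * (1 / (4 * w)) :=
      mul_le_mul_of_nonneg_left hα2 (by positivity)
    have h6 : ((a' : ℝ) + 1) * (1 / (4 * w)) ≤ k' := by
      rw [mul_one_div, div_le_iff₀ h4w]
      linarith
    linarith
  have c8 : ((1 : ℕ) : ℝ) ≤ ε * k' := by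
    have : 1 / ε < k' := by linarith
    rw [div_lt_iff₀ hε] at this
    push_cast
    linarith
  have i1 := (abs_sub_le_iff.1 (hk₀ a' k 1 c1 c2 c3 c4)).1
  have i2 := (abs_sub_le_iff.1 (hk₀ k' (a' + 1) 1 c5 c6 c7 c8)).1
  rw [hlr]
  constructor
  · linarith
  · linarith

end RectSubseqLimits

open RectSubseqLimits in
/-- Registered stub of this support file: **box duality at finite mesh, up to `2η`**
(`RectSubseqLimits.bt_dual`): for the left–right family `Q` and the bottom–top family `Q'` of
boxes `(0,w) × (0,1)`, every `w > 0` and `η > 0`, for all large `k`,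
`1 - P[Q w, 1/(k+2)] ≤ P[Q' w, 1/(k+2)] ≤ 1 - P[Q w, 1/(k+2)] + 2η`.
[cite: BollobasRiordan2006, Ch. 3 Lemma 1 and Ch. 7 §7.1] -/
theorem stub_rectSubseqLimits_boxDuality :
    ∀ (Q Q' : ℝ → ConformalRectangle),
      (∀ w : ℝ, 0 < w → (Q w).carrier = (Set.Ioo (0 : ℝ) w ×ℂ Set.Ioo (0 : ℝ) 1) ∧
        (Q w).arc 0 = {z : ℂ | z.re = 0 ∧ z.im ∈ Set.Icc (0 : ℝ) 1} ∧
        (Q w).arc 2 = {z : ℂ | z.re = w ∧ z.im ∈ Set.Icc (0 : ℝ) 1}) →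
      (∀ w : ℝ, 0 < w → (Q' w).carrier = (Set.Ioo (0 : ℝ) w ×ℂ Set.Ioo (0 : ℝ) 1) ∧
        (Q' w).arc 0 = {z : ℂ | z.im = 0 ∧ z.re ∈ Set.Icc (0 : ℝ) w} ∧
        (Q' w).arc 2 = {z : ℂ | z.im = 1 ∧ z.re ∈ Set.Icc (0 : ℝ) w}) →
      ∀ w : ℝ, 0 < w → ∀ η : ℝ, 0 < η → ∃ K : ℕ, ∀ k : ℕ, K ≤ k →
        1 - bondDomainCrossingProb (Q w) (1 / ((k : ℝ) + 2)) ≤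
            bondDomainCrossingProb (Q' w) (1 / ((k : ℝ) + 2)) ∧
          bondDomainCrossingProb (Q' w) (1 / ((k : ℝ) + 2)) ≤
            1 - bondDomainCrossingProb (Q w) (1 / ((k : ℝ) + 2)) + 2 * η :=
  fun _ _ hQ hQ' _ hw _ hη => bt_dual hQ hQ' hw hη

end Summit.CriticalPhenomena.CardyFormulaZ2.Cruxes.DyadicLatticeBetaLaw.Stubs

end
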